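import Literature.Geometry.Kaehler.ComplexTorusAnalyticMovingLemma
import Literature.Geometry.Kaehler.ComplexTorusAnalyticClassesKunneth
import Literature.Geometry.Kaehler.ComplexTorusAnalyticClassesDescent
import Literature.Geometry.Kaehler.ComplexTorusAnalyticCycleClassTranspose
import Literature.Geometry.Kaehler.ComplexTorusCorrespondenceValenceKunneth
import HarnessLib

/-!
# The extreme Künneth components of the class of an analytic subset of `X₁ × X₂` are the classes
# `[Z_t × X₂]` and `[X₁ × Zˢ]` of its generic slices

Let `X₁ = E₁/Λ₁`, `X₂ = E₂/Λ₂` be complex tori (`dim X₂ = g₂`, `dim X₁ = g₁`), `K_s` the Künneth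
projector of `H^{2p}(X₁ × X₂, ℂ)` onto `H^{2p-s}(X₁) ⊗ H^s(X₂)` (`kunnethComponent`, read through the
presentation `P : WithLp 2 (E₁ × E₂) ≃ E₁ × E₂` as in `ComplexTorusAnalyticClassesKunneth`), `i₀ : x ↦ (x, 0)`,
`i₁ : y ↦ (0, y)`, `pr₁, pr₂` the projections.

* §1 The two extreme projectors are restriction-then-pull-back, `K_0 γ = pr₁^*(i₀^*γ)` and
  `K_k γ = pr₂^*(i₁^*γ)` (the tree's `kunnethComponent_zero_eq_comp_inl_comp_fst`,
  `kunnethComponent_self_eq_comp_inr_comp_snd`), read on the Euclidean product torus with the analytic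
  representations of `i₀`, `i₁` (`kunnethComponent_zero_compContinuousLinearMap_eq`,
  `kunnethComponent_self_compContinuousLinearMap_eq`).
* §2 For `Z ⊆ X₁ × X₂` closed analytic of pure dimension `q + g₂`, `0 < q`, `0 < g₂`, and Haar-a.e.
  `t ∈ X₂`: the slice `Z_t = Z ∩ (X₁ × {t})` is empty or of pure dimension `q`
  (`ae_volume_fibreSlice_eq_empty_or_hasPureDim`), its class is the restriction of the class,
  `cl_{e₁}(Z_t) = sign(e₁) sign(e) · i₀^*[Z]_e` (`ae_volume_setCycleClass_fibreSlice_eq_inl_pullback` — the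
  Haar-a.e. form of `ae_setCycleClass_fibreSlice_eq_inl_pullback`), and therefore
  **`K_0[Z] = [Z_t × X₂]`** (`ae_kunnethComponent_zero_analyticCycleClass_eq_prod_univ`; no sign), with
  `K_0[Z] = 0` iff a.e. slice is empty (`kunnethComponent_zero_analyticCycleClass_eq_zero_or_ae_eq_prod_univ`).
* §3 Symmetrically over the first factor (through the exchange isogeny `X₂ × X₁ → X₁ × X₂` and
  `[ᵗZ] = ± [Z] ∘ swap`): for `Z` of pure dimension `q + g₁`, for Haar-a.e. `s ∈ X₁` the slice
  `Zˢ = Z ∩ ({s} × X₂)` has class `sign(e₁) · i₁^*[Z]_{e₁ ⊔ e₂}` (`ae_volume_setCycleClass_fstSlice_eq_inr_pullback`)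
  and **`K_{2p}[Z] = [X₁ × Zˢ]`** (`ae_kunnethComponent_self_analyticCycleClass_eq_univ_prod`).

So the extreme Künneth components of an effective analytic class are effective (classes of actual
analytic subsets), refining `kunnethComponent_mem_analyticClasses` (`K_s Aᵖ ⊆ Aᵖ`, Lieberman) at
`s = 0, 2p`: Lange, §6.3.3 — for `x = cl(Z)`, `p₁^* i₀^* x = x ⊗ 1`-component, "`1 = cl(X̂)`"; Fulton,
Example 10.1.2: `α_t = i_t^*(α)` for the fibres of a family, all `i_t^*` equal (`X₂` connected).

Theorems only; no definitions, no instances, no named facts.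

## References

* [Lange2023AbelianVarietiesComplex] H. Lange, *Abelian Varieties over the Complex Numbers*, Springer
  2023, §6.3.3 (6.14)–(6.16), Prop. 6.3.8; §6.2.4 proof of Prop. 6.2.20 (`p₁^* x = x ⊗ 1`).
* [VoisinHodgeI2002] C. Voisin, *Hodge Theory and Complex Algebraic Geometry I*, CUP 2002, §11.3.3
  Thm. 11.38 (Künneth components), §11.1.2.
* [Fulton1998] W. Fulton, *Intersection Theory*, 2nd ed., Springer 1998, §10.1 Example 10.1.2, §10.2
  Prop. 10.2, §19.2 Cor. 19.2 (b), §1.10 Prop. 1.10 (a).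
* [Federer1969] H. Federer, *Geometric Measure Theory*, Springer 1969, 4.3.1–4.3.2.
* [BombieriGubler2001] E. Bombieri, W. Gubler, *Heights in Diophantine Geometry*, CUP 2006, App. C
  Cor. C.1.2.
-/

noncomputable section

open scoped Manifold Topology ENNReal NNReal
open MeasureTheory MeasureTheory.Measure Set Function Filter Module TopologicalSpace WithLp Metric
open Literature.Geometry.GeometricMeasureTheory Literature.Analysis.Complex Literature.LinearAlgebra.Alternating

universe u

namespace Literature.Geometry.Kaehler

-- Nested operator-norm instances on `V [⋀^Fin m]→L[ℝ] F`, as in the tree's `Currents*.lean` files.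
set_option maxSynthPendingDepth 2

namespace ComplexTorus

/-! ### §1 On the Euclidean product torus: `K_0 β = pr₁^* i₀^* β`, `K_{2p} β = pr₂^* i₁^* β` -/

section Torus

variable {ι₁ ι₂ : Type*} [Fintype ι₁] [Fintype ι₂] [DecidableEq ι₁] [DecidableEq ι₂]
  {E₁ : Type u} [NormedAddCommGroup E₁] [InnerProductSpace ℂ E₁] [FiniteDimensional ℂ E₁]
  [MeasurableSpace E₁] [BorelSpace E₁]
  {E₂ : Type u} [NormedAddCommGroup E₂] [InnerProductSpace ℂ E₂] [FiniteDimensional ℂ E₂]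
  [MeasurableSpace E₂] [BorelSpace E₂]
  (Φ₁ : (ι₁ → ℝ) ≃L[ℝ] E₁) (Φ₂ : (ι₂ → ℝ) ≃L[ℝ] E₂) {n₁ n₂ : ℕ} (e₁ : Fin n₁ ≃ ι₁) (e₂ : Fin n₂ ≃ ι₂)
  {p : ℕ}

omit [Fintype ι₁] [Fintype ι₂] [DecidableEq ι₁] [DecidableEq ι₂] [FiniteDimensional ℂ E₁] [MeasurableSpace E₁]
  [BorelSpace E₁] [FiniteDimensional ℂ E₂] [MeasurableSpace E₂] [BorelSpace E₂] in
/-- Complex scalars pass through the pull-back of complex-valued forms. [folklore] -/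
private theorem complex_smul_compContinuousLinearMap₃₆ {V V' : Type*} [NormedAddCommGroup V] [NormedSpace ℝ V]
    [NormedAddCommGroup V'] [NormedSpace ℝ V'] {k : ℕ} (c : ℂ) (α : V [⋀^Fin k]→L[ℝ] ℂ) (f : V' →L[ℝ] V) :
    (c • α).compContinuousLinearMap f = c • α.compContinuousLinearMap f := by
  ext v
  simp [ContinuousAlternatingMap.compContinuousLinearMap_apply]

omit [DecidableEq ι₂] [FiniteDimensional ℂ E₁] [MeasurableSpace E₁] [BorelSpace E₁]
  [FiniteDimensional ℂ E₂] [MeasurableSpace E₂] [BorelSpace E₂] in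
/-- **`K_0 β = pr₁^*(i₀^*β)` on `X₁ × X₂`**: the Künneth component of type `(2p, 0)` of a class `β` of the
Euclidean product torus (read through `P : WithLp 2 (E₁ × E₂) ≃ E₁ × E₂`) is the pull-back along
`pr₁ : X₁ × X₂ → X₁` of its restriction along `i₀ : X₁ → X₁ × X₂`, `x ↦ (x, 0)` (analytic representation
`realRep (inlMatrix)`). [cite: Lange2023AbelianVarietiesComplex, §6.3.3 (6.14) and §6.2.4 proof of Prop. 6.2.20]
[cite: VoisinHodgeI2002, §11.3.3 Thm. 11.38] -/
theorem kunnethComponent_zero_compContinuousLinearMap_eq {k : ℕ} (β : WithLp 2 (E₁ × E₂) [⋀^Fin k]→L[ℝ] ℂ) :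
    (kunnethComponent 0 (β.compContinuousLinearMap
        ((WithLp.prodContinuousLinearEquiv 2 ℝ E₁ E₂).symm : E₁ × E₂ →L[ℝ] WithLp 2 (E₁ × E₂)))).compContinuousLinearMap
      (WithLp.prodContinuousLinearEquiv 2 ℝ E₁ E₂ : WithLp 2 (E₁ × E₂) →L[ℝ] E₁ × E₂) =
      (β.compContinuousLinearMap (realRep Φ₁ (prodPeriodL2 Φ₁ Φ₂) (inlMatrix ι₁ ι₂))).compContinuousLinearMap
        ((ContinuousLinearMap.fst ℝ E₁ E₂).comp
          (WithLp.prodContinuousLinearEquiv 2 ℝ E₁ E₂ : WithLp 2 (E₁ × E₂) →L[ℝ] E₁ × E₂)) := by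
  rw [kunnethComponent_zero_eq_comp_inl_comp_fst]
  ext v
  simp only [ContinuousAlternatingMap.compContinuousLinearMap_apply, Function.comp_def,
    ContinuousLinearMap.coe_comp, realRep_inlMatrix_prodPeriodL2_apply]
  rfl

omit [DecidableEq ι₁] [FiniteDimensional ℂ E₁] [MeasurableSpace E₁] [BorelSpace E₁]
  [FiniteDimensional ℂ E₂] [MeasurableSpace E₂] [BorelSpace E₂] in
/-- **`K_k β = pr₂^*(i₁^*β)` on `X₁ × X₂`**: the Künneth component of type `(0, k)` of a `k`-class `β` of
the Euclidean product torus is the pull-back along `pr₂` of its restriction along `i₁ : X₂ → X₁ × X₂`,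
`y ↦ (0, y)` (analytic representation `realRep (inrMatrix)`).
[cite: Lange2023AbelianVarietiesComplex, §6.3.3 (6.14)] [cite: VoisinHodgeI2002, §11.3.3 Thm. 11.38] -/
theorem kunnethComponent_self_compContinuousLinearMap_eq {k : ℕ} (β : WithLp 2 (E₁ × E₂) [⋀^Fin k]→L[ℝ] ℂ) :
    (kunnethComponent k (β.compContinuousLinearMap
        ((WithLp.prodContinuousLinearEquiv 2 ℝ E₁ E₂).symm : E₁ × E₂ →L[ℝ] WithLp 2 (E₁ × E₂)))).compContinuousLinearMap
      (WithLp.prodContinuousLinearEquiv 2 ℝ E₁ E₂ : WithLp 2 (E₁ × E₂) →L[ℝ] E₁ × E₂) =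
      (β.compContinuousLinearMap (realRep Φ₂ (prodPeriodL2 Φ₁ Φ₂) (inrMatrix ι₁ ι₂))).compContinuousLinearMap
        ((ContinuousLinearMap.snd ℝ E₁ E₂).comp
          (WithLp.prodContinuousLinearEquiv 2 ℝ E₁ E₂ : WithLp 2 (E₁ × E₂) →L[ℝ] E₁ × E₂)) := by
  rw [kunnethComponent_self_eq_comp_inr_comp_snd]
  ext v
  simp only [ContinuousAlternatingMap.compContinuousLinearMap_apply, Function.comp_def,
    ContinuousLinearMap.coe_comp, realRep_inrMatrix_prodPeriodL2_apply]
  rfl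

/-! ### §2 Over the second factor: `cl(Z_t) = ± i₀^*[Z]` and `K_0[Z] = [Z_t × X₂]` for Haar-a.e. `t ∈ X₂` -/

omit [Fintype ι₂] [DecidableEq ι₂] in
/-- The Euclidean Hausdorff measure `𝓗^{2 dim_ℂ E₂}` of `E₂` is a Haar (Lebesgue) measure. [folklore] -/
private theorem isAddHaarMeasure_euclideanHausdorffMeasure_two_mul_finrank₂ :
    (μHE[2 * finrank ℂ E₂] : Measure E₂).IsAddHaarMeasure := by
  letI : InnerProductSpace ℝ E₂ := InnerProductSpace.complexToReal
  haveI : FiniteDimensional ℝ E₂ := FiniteDimensional.complexToReal E₂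
  have hV : finrank ℝ E₂ = 2 * finrank ℂ E₂ := by rw [finrank_real_of_complex]
  rw [← hV, InnerProductSpace.euclideanHausdorffMeasure_eq_volume]; infer_instance

/-- The class of the empty set is `0`. [folklore] -/
private theorem setCycleClass_empty₂ {ι : Type*} [Fintype ι] [DecidableEq ι] {E : Type u} [NormedAddCommGroup E]
    [InnerProductSpace ℂ E] [FiniteDimensional ℂ E] [MeasurableSpace E] [BorelSpace E] (Φ : (ι → ℝ) ≃L[ℝ] E)
    {n k d : ℕ} (e : Fin n ≃ ι) (h : 2 * d + k = n) : setCycleClass Φ e h (∅ : Set (ComplexTorus Φ)) = 0 := by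
  rw [setCycleClass, dif_neg]
  exact fun hp ↦ hp.nonempty.ne_empty rfl

omit [DecidableEq ι₁] [DecidableEq ι₂] in
/-- **For Haar-a.e. `t ∈ X₂` the slice `Z_t = {x | (x, t) ∈ Z}` of a closed analytic `Z ⊆ X₁ × X₂` of pure
dimension `q + dim X₂` is empty or of pure dimension `q`** (any `q ≥ 0`; the Lebesgue-a.e. statement
`ae_hasPureDim_fibreSlice` descended to the torus `X₂ = E₂/Λ₂`).
[cite: Federer1969, 4.3.1–4.3.2] [cite: Fulton1998, Appendix B.9.2 (a)] [cite: BombieriGubler2001, Appendix C Cor. C.1.2] -/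
theorem ae_volume_fibreSlice_eq_empty_or_hasPureDim {q : ℕ} {Z : Set (ComplexTorus (prodPeriodL2 Φ₁ Φ₂))}
    (hZ : HasPureDim 𝓘(ℂ, WithLp 2 (E₁ × E₂)) Z (q + finrank ℂ E₂)) :
    ∀ᵐ t ∂(volume : Measure (ComplexTorus Φ₂)),
      {x : ComplexTorus Φ₁ | (prodHomeomorphL2 Φ₁ Φ₂).symm (x, t) ∈ Z} = ∅ ∨
        HasPureDim 𝓘(ℂ, E₁) {x : ComplexTorus Φ₁ | (prodHomeomorphL2 Φ₁ Φ₂).symm (x, t) ∈ Z} q := by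
  haveI := isAddHaarMeasure_euclideanHausdorffMeasure_two_mul_finrank₂ (E₂ := E₂)
  refine ae_volume_of_ae_cover Φ₂ (μ := (μHE[2 * finrank ℂ E₂] : Measure E₂))
    (p := fun s ↦ {x : ComplexTorus Φ₁ | (prodHomeomorphL2 Φ₁ Φ₂).symm (x, s) ∈ Z} = ∅ ∨
      HasPureDim 𝓘(ℂ, E₁) {x : ComplexTorus Φ₁ | (prodHomeomorphL2 Φ₁ Φ₂).symm (x, s) ∈ Z} q) ?_
  filter_upwards [ae_hasPureDim_fibreSlice Φ₁ Φ₂ (μHE[2 * finrank ℂ E₂] : Measure E₂) hZ] with t ht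
  exact ht.2.2

include e₁ in
open Classical in
/-- **EITHER a.e. slice is empty OR a.e. slice is of pure dimension `q`** (`0 < q`), for Haar-a.e.
`t ∈ X₂` (`ae_fibreSlice_eq_empty_or_ae_hasPureDim` descended to `X₂`).
[cite: Fulton1998, Appendix B.9.2 and §10.2 Prop. 10.2] [cite: BombieriGubler2001, Appendix C Cor. C.1.2] -/
theorem ae_volume_fibreSlice_eq_empty_or_ae_volume_hasPureDim {q : ℕ} (hq : 0 < q) (h₁ : 2 * q + 2 * p = n₁)
    {Z : Set (ComplexTorus (prodPeriodL2 Φ₁ Φ₂))} (hZ : HasPureDim 𝓘(ℂ, WithLp 2 (E₁ × E₂)) Z (q + finrank ℂ E₂)) :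
    (∀ᵐ t ∂(volume : Measure (ComplexTorus Φ₂)),
        {x : ComplexTorus Φ₁ | (prodHomeomorphL2 Φ₁ Φ₂).symm (x, t) ∈ Z} = ∅) ∨
      ∀ᵐ t ∂(volume : Measure (ComplexTorus Φ₂)),
        HasPureDim 𝓘(ℂ, E₁) {x : ComplexTorus Φ₁ | (prodHomeomorphL2 Φ₁ Φ₂).symm (x, t) ∈ Z} q := by
  haveI := isAddHaarMeasure_euclideanHausdorffMeasure_two_mul_finrank₂ (E₂ := E₂)
  rcases ae_fibreSlice_eq_empty_or_ae_hasPureDim Φ₁ Φ₂ e₁ hq h₁ hZ with h | h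
  · exact Or.inl (ae_volume_of_ae_cover Φ₂
      (p := fun s ↦ {x : ComplexTorus Φ₁ | (prodHomeomorphL2 Φ₁ Φ₂).symm (x, s) ∈ Z} = ∅) h)
  · exact Or.inr (ae_volume_of_ae_cover Φ₂
      (p := fun s ↦ HasPureDim 𝓘(ℂ, E₁) {x : ComplexTorus Φ₁ | (prodHomeomorphL2 Φ₁ Φ₂).symm (x, s) ∈ Z} q) h)

open Classical in
/-- **THE CLASS OF THE GENERIC FIBRE IS THE RESTRICTION OF THE CLASS, for Haar-a.e. point of `X₂`**: for
`Z ⊆ X₁ × X₂` closed analytic of pure dimension `q + dim X₂` (`0 < q`, `0 < dim X₂`), codimension `p`,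
for Haar-a.e. `t ∈ X₂`, `cl_{e₁}(Z_t) = sign(e₁) sign(e) · i₀^*[Z]_e` — `ae_setCycleClass_fibreSlice_eq_inl_pullback`
(Lebesgue-a.e. `t ∈ E₂`, slice over `π t`) descended along `π : E₂ → X₂`. Fulton, Example 10.1.2:
"`α_t = i_t^*(α)`". [cite: Fulton1998, §10.1 Examples 10.1.1–10.1.2 and §19.2 Cor. 19.2 (b)]
[cite: Federer1969, 4.3.1–4.3.2] [cite: BombieriGubler2001, Appendix C Cor. C.1.2] -/
theorem ae_volume_setCycleClass_fibreSlice_eq_inl_pullback (hE₂ : 0 < finrank ℂ E₂) {n q : ℕ}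
    (e : Fin n ≃ ι₁ ⊕ ι₂) (hq : 0 < q) (h₁ : 2 * q + 2 * p = n₁) (hk : 2 * (q + finrank ℂ E₂) + 2 * p = n)
    {Z : Set (ComplexTorus (prodPeriodL2 Φ₁ Φ₂))} (hZ : HasPureDim 𝓘(ℂ, WithLp 2 (E₁ × E₂)) Z (q + finrank ℂ E₂)) :
    ∀ᵐ t ∂(volume : Measure (ComplexTorus Φ₂)),
      setCycleClass Φ₁ e₁ h₁ {x : ComplexTorus Φ₁ | (prodHomeomorphL2 Φ₁ Φ₂).symm (x, t) ∈ Z} =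
        ((orientationSign Φ₁ e₁ * orientationSign (prodPeriod Φ₁ Φ₂) e : ℤ) : ℂ) •
          (analyticCycleClass (prodPeriodL2 Φ₁ Φ₂) e hk hZ).compContinuousLinearMap
            (realRep Φ₁ (prodPeriodL2 Φ₁ Φ₂) (inlMatrix ι₁ ι₂)) := by
  haveI := isAddHaarMeasure_euclideanHausdorffMeasure_two_mul_finrank₂ (E₂ := E₂)
  exact ae_volume_of_ae_cover Φ₂
    (p := fun s ↦ setCycleClass Φ₁ e₁ h₁ {x : ComplexTorus Φ₁ | (prodHomeomorphL2 Φ₁ Φ₂).symm (x, s) ∈ Z} =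
      ((orientationSign Φ₁ e₁ * orientationSign (prodPeriod Φ₁ Φ₂) e : ℤ) : ℂ) •
        (analyticCycleClass (prodPeriodL2 Φ₁ Φ₂) e hk hZ).compContinuousLinearMap
          (realRep Φ₁ (prodPeriodL2 Φ₁ Φ₂) (inlMatrix ι₁ ι₂)))
    (ae_setCycleClass_fibreSlice_eq_inl_pullback Φ₁ Φ₂ hE₂ e₁ e hq h₁ hk hZ)

open Classical in
/-- **`K_0[Z] = sign(e₂) · pr₁^* cl_{e₁}(Z_t)` for Haar-a.e. `t ∈ X₂`**: the Künneth component of type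
`(2p, 0)` of the class of `Z ⊆ X₁ × X₂` (closed analytic, pure dimension `q + dim X₂`, `0 < q`,
`0 < dim X₂`) is `pr₁^* i₀^*[Z] = sign(e₂) · pr₁^* cl(Z_t)` (`sign(e₁) sign(e₁ ⊔ e₂) = sign(e₂)`).
[cite: Lange2023AbelianVarietiesComplex, §6.3.3 (6.14)–(6.16) and §6.2.4 proof of Prop. 6.2.20]
[cite: Fulton1998, §10.1 Example 10.1.2] -/
theorem ae_kunnethComponent_zero_analyticCycleClass_eq (hE₂ : 0 < finrank ℂ E₂) {q : ℕ} (hq : 0 < q)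
    (h₁ : 2 * q + 2 * p = n₁) (hk : 2 * (q + finrank ℂ E₂) + 2 * p = n₁ + n₂)
    {Z : Set (ComplexTorus (prodPeriodL2 Φ₁ Φ₂))} (hZ : HasPureDim 𝓘(ℂ, WithLp 2 (E₁ × E₂)) Z (q + finrank ℂ E₂)) :
    ∀ᵐ t ∂(volume : Measure (ComplexTorus Φ₂)),
      (kunnethComponent 0 ((analyticCycleClass (prodPeriodL2 Φ₁ Φ₂) (sumEnum e₁ e₂) hk hZ).compContinuousLinearMap
          ((WithLp.prodContinuousLinearEquiv 2 ℝ E₁ E₂).symm : E₁ × E₂ →L[ℝ] WithLp 2 (E₁ × E₂)))).compContinuousLinearMap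
        (WithLp.prodContinuousLinearEquiv 2 ℝ E₁ E₂ : WithLp 2 (E₁ × E₂) →L[ℝ] E₁ × E₂) =
      (orientationSign Φ₂ e₂ : ℂ) •
        (setCycleClass Φ₁ e₁ h₁ {x : ComplexTorus Φ₁ | (prodHomeomorphL2 Φ₁ Φ₂).symm (x, t) ∈ Z}).compContinuousLinearMap
          ((ContinuousLinearMap.fst ℝ E₁ E₂).comp
            (WithLp.prodContinuousLinearEquiv 2 ℝ E₁ E₂ : WithLp 2 (E₁ × E₂) →L[ℝ] E₁ × E₂)) := by
  have hsign : ((orientationSign Φ₁ e₁ * orientationSign (prodPeriod Φ₁ Φ₂) (sumEnum e₁ e₂) : ℤ) : ℂ) =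
      (orientationSign Φ₂ e₂ : ℂ) := by
    rw [orientationSign_sumEnum_eq_mul Φ₁ Φ₂ e₁ e₂, ← mul_assoc, orientationSign_mul_self Φ₁ e₁, one_mul]
  have hss₂ : ((orientationSign Φ₂ e₂ : ℤ) : ℂ) * orientationSign Φ₂ e₂ = 1 := by
    exact_mod_cast orientationSign_mul_self Φ₂ e₂
  filter_upwards [ae_volume_setCycleClass_fibreSlice_eq_inl_pullback Φ₁ Φ₂ e₁ hE₂ (sumEnum e₁ e₂) hq h₁ hk hZ]
    with t ht
  rw [hsign] at ht
  rw [kunnethComponent_zero_compContinuousLinearMap_eq Φ₁ Φ₂, ht, complex_smul_compContinuousLinearMap₃₆, smul_smul,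
    hss₂, one_smul]

open Classical in
/-- **`K_0[Z] = [Z_t × X₂]` for Haar-a.e. `t ∈ X₂`.** For `Z ⊆ X₁ × X₂` closed analytic of pure dimension
`q + dim X₂` (`0 < q`, `0 < dim X₂`) and Haar-a.e. `t ∈ X₂`: either the slice `Z_t` is empty and
`K_0[Z] = 0`, or `Z_t` is (closed analytic) of pure dimension `q` and the Künneth component of type
`(2p, 0)` of `[Z]_{e₁ ⊔ e₂}` IS the class `[Z_t × X₂]_{e₁ ⊔ e₂}` of the analytic subset `Z_t × X₂` — no sign
(`[Z_t × X₂] = sign(e₂) · pr₁^*[Z_t]`, `analyticCycleClass_prodL2_prod_univ`). The extreme Künneth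
component of an effective analytic class is effective.
[cite: Lange2023AbelianVarietiesComplex, §6.3.3 Prop. 6.3.8 and §6.2.4 proof of Prop. 6.2.20]
[cite: Fulton1998, §10.1 Example 10.1.2 and §1.10 Prop. 1.10 (a)] -/
theorem ae_kunnethComponent_zero_analyticCycleClass_eq_prod_univ (hE₂ : 0 < finrank ℂ E₂) {q : ℕ} (hq : 0 < q)
    (h₁ : 2 * q + 2 * p = n₁) (hk : 2 * (q + finrank ℂ E₂) + 2 * p = n₁ + n₂)
    {Z : Set (ComplexTorus (prodPeriodL2 Φ₁ Φ₂))} (hZ : HasPureDim 𝓘(ℂ, WithLp 2 (E₁ × E₂)) Z (q + finrank ℂ E₂)) :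
    ∀ᵐ t ∂(volume : Measure (ComplexTorus Φ₂)),
      ({x : ComplexTorus Φ₁ | (prodHomeomorphL2 Φ₁ Φ₂).symm (x, t) ∈ Z} = ∅ ∧
        (kunnethComponent 0 ((analyticCycleClass (prodPeriodL2 Φ₁ Φ₂) (sumEnum e₁ e₂) hk hZ).compContinuousLinearMap
            ((WithLp.prodContinuousLinearEquiv 2 ℝ E₁ E₂).symm : E₁ × E₂ →L[ℝ] WithLp 2 (E₁ × E₂)))).compContinuousLinearMap
          (WithLp.prodContinuousLinearEquiv 2 ℝ E₁ E₂ : WithLp 2 (E₁ × E₂) →L[ℝ] E₁ × E₂) = 0) ∨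
      ∃ hZt : HasPureDim 𝓘(ℂ, E₁) {x : ComplexTorus Φ₁ | (prodHomeomorphL2 Φ₁ Φ₂).symm (x, t) ∈ Z} q,
        (kunnethComponent 0 ((analyticCycleClass (prodPeriodL2 Φ₁ Φ₂) (sumEnum e₁ e₂) hk hZ).compContinuousLinearMap
            ((WithLp.prodContinuousLinearEquiv 2 ℝ E₁ E₂).symm : E₁ × E₂ →L[ℝ] WithLp 2 (E₁ × E₂)))).compContinuousLinearMap
          (WithLp.prodContinuousLinearEquiv 2 ℝ E₁ E₂ : WithLp 2 (E₁ × E₂) →L[ℝ] E₁ × E₂) =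
          analyticCycleClass (prodPeriodL2 Φ₁ Φ₂) (sumEnum e₁ e₂) hk
            (hasPureDim_preimage_prodHomeomorphL2_prod_univ Φ₁ Φ₂ hZt) := by
  have hn₂ : 2 * finrank ℂ E₂ + 0 = n₂ := by have := finrank_complex_mul_two Φ₂ e₂; omega
  filter_upwards [ae_kunnethComponent_zero_analyticCycleClass_eq Φ₁ Φ₂ e₁ e₂ hE₂ hq h₁ hk hZ,
    ae_volume_fibreSlice_eq_empty_or_hasPureDim Φ₁ Φ₂ (q := q) hZ] with t ht hdich
  rcases hdich with h | h
  · refine Or.inl ⟨h, ?_⟩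
    rw [ht, h, setCycleClass_empty₂]
    have h0 : (0 : E₁ [⋀^Fin (2 * p)]→L[ℝ] ℂ).compContinuousLinearMap ((ContinuousLinearMap.fst ℝ E₁ E₂).comp
        (WithLp.prodContinuousLinearEquiv 2 ℝ E₁ E₂ : WithLp 2 (E₁ × E₂) →L[ℝ] E₁ × E₂)) = 0 :=
      ContinuousAlternatingMap.ext fun v ↦ rfl
    rw [h0, smul_zero]
  · refine Or.inr ⟨h, ?_⟩
    rw [ht, setCycleClass_of_hasPureDim Φ₁ e₁ h₁ h, analyticCycleClass_prodL2_prod_univ Φ₁ Φ₂ e₁ e₂ h h₁ hn₂ hk]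

open Classical in
/-- **`K_0[Z]` vanishes iff the generic slice is empty; otherwise it is the class of `Z_t × X₂` for a.e.
`t`.** (`Z ⊆ X₁ × X₂` closed analytic of pure dimension `q + dim X₂`, `0 < q`, `0 < dim X₂`.)
[cite: Lange2023AbelianVarietiesComplex, §6.3.3 Prop. 6.3.8] [cite: Fulton1998, §10.1 Example 10.1.2 and §10.2 Prop. 10.2] -/
theorem kunnethComponent_zero_analyticCycleClass_eq_zero_or_ae_eq_prod_univ (hE₂ : 0 < finrank ℂ E₂) {q : ℕ}
    (hq : 0 < q) (h₁ : 2 * q + 2 * p = n₁) (hk : 2 * (q + finrank ℂ E₂) + 2 * p = n₁ + n₂)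
    {Z : Set (ComplexTorus (prodPeriodL2 Φ₁ Φ₂))} (hZ : HasPureDim 𝓘(ℂ, WithLp 2 (E₁ × E₂)) Z (q + finrank ℂ E₂)) :
    ((kunnethComponent 0 ((analyticCycleClass (prodPeriodL2 Φ₁ Φ₂) (sumEnum e₁ e₂) hk hZ).compContinuousLinearMap
            ((WithLp.prodContinuousLinearEquiv 2 ℝ E₁ E₂).symm : E₁ × E₂ →L[ℝ] WithLp 2 (E₁ × E₂)))).compContinuousLinearMap
          (WithLp.prodContinuousLinearEquiv 2 ℝ E₁ E₂ : WithLp 2 (E₁ × E₂) →L[ℝ] E₁ × E₂) = 0 ∧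
        ∀ᵐ t ∂(volume : Measure (ComplexTorus Φ₂)),
          {x : ComplexTorus Φ₁ | (prodHomeomorphL2 Φ₁ Φ₂).symm (x, t) ∈ Z} = ∅) ∨
      ∀ᵐ t ∂(volume : Measure (ComplexTorus Φ₂)),
        ∃ hZt : HasPureDim 𝓘(ℂ, E₁) {x : ComplexTorus Φ₁ | (prodHomeomorphL2 Φ₁ Φ₂).symm (x, t) ∈ Z} q,
          (kunnethComponent 0 ((analyticCycleClass (prodPeriodL2 Φ₁ Φ₂) (sumEnum e₁ e₂) hk hZ).compContinuousLinearMap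
              ((WithLp.prodContinuousLinearEquiv 2 ℝ E₁ E₂).symm : E₁ × E₂ →L[ℝ] WithLp 2 (E₁ × E₂)))).compContinuousLinearMap
            (WithLp.prodContinuousLinearEquiv 2 ℝ E₁ E₂ : WithLp 2 (E₁ × E₂) →L[ℝ] E₁ × E₂) =
            analyticCycleClass (prodPeriodL2 Φ₁ Φ₂) (sumEnum e₁ e₂) hk
              (hasPureDim_preimage_prodHomeomorphL2_prod_univ Φ₁ Φ₂ hZt) := by
  have hae := ae_kunnethComponent_zero_analyticCycleClass_eq_prod_univ Φ₁ Φ₂ e₁ e₂ hE₂ hq h₁ hk hZ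
  rcases ae_volume_fibreSlice_eq_empty_or_ae_volume_hasPureDim Φ₁ Φ₂ e₁ (p := p) hq h₁ hZ with h | h
  · refine Or.inl ⟨?_, h⟩
    have hboth : ∀ᵐ t ∂(volume : Measure (ComplexTorus Φ₂)),
        (kunnethComponent 0 ((analyticCycleClass (prodPeriodL2 Φ₁ Φ₂) (sumEnum e₁ e₂) hk hZ).compContinuousLinearMap
            ((WithLp.prodContinuousLinearEquiv 2 ℝ E₁ E₂).symm : E₁ × E₂ →L[ℝ] WithLp 2 (E₁ × E₂)))).compContinuousLinearMap
          (WithLp.prodContinuousLinearEquiv 2 ℝ E₁ E₂ : WithLp 2 (E₁ × E₂) →L[ℝ] E₁ × E₂) = 0 := by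
      filter_upwards [hae, h] with t ht ht'
      rcases ht with ⟨_, h0⟩ | ⟨hp, _⟩
      · exact h0
      · exact absurd ht' hp.nonempty.ne_empty
    obtain ⟨t, ht⟩ := hboth.exists
    exact ht
  · right
    filter_upwards [hae, h] with t ht ht'
    rcases ht with ⟨he, _⟩ | hp
    · exact absurd he ht'.nonempty.ne_empty
    · exact hp

/-! ### §3 Over the first factor: `cl(Zˢ) = ± i₁^*[Z]` and `K_{2p}[Z] = [X₁ × Zˢ]` for Haar-a.e. `s ∈ X₁` -/

omit [FiniteDimensional ℂ E₁] [MeasurableSpace E₁] [BorelSpace E₁] [FiniteDimensional ℂ E₂] [MeasurableSpace E₂]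
  [BorelSpace E₂] in
/-- **The slices over the first factor are the slices over the second factor of the transpose**:
`{y | (y, s) ∈ ᵗZ} = {y | (s, y) ∈ Z}` for `ᵗZ = swap⁻¹ Z ⊆ X₂ × X₁`.
[cite: Lange2023AbelianVarietiesComplex, §6.2.2 p. 304] -/
theorem fibreSlice_preimage_swap_eq (Z : Set (ComplexTorus (prodPeriodL2 Φ₁ Φ₂))) (s : ComplexTorus Φ₁) :
    {y : ComplexTorus Φ₂ | (prodHomeomorphL2 Φ₂ Φ₁).symm (y, s) ∈
      mapMatrix (prodPeriodL2 Φ₂ Φ₁) (prodPeriodL2 Φ₁ Φ₂)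
        (Matrix.fromBlocks (0 : Matrix ι₁ ι₂ ℤ) (1 : Matrix ι₁ ι₁ ℤ) (1 : Matrix ι₂ ι₂ ℤ) (0 : Matrix ι₂ ι₁ ℤ)) ⁻¹' Z} =
      {y : ComplexTorus Φ₂ | (prodHomeomorphL2 Φ₁ Φ₂).symm (s, y) ∈ Z} := by
  ext y
  simp only [mem_setOf_eq, mem_preimage]
  have h := prodHomeomorphL2_mapMatrix_swap Φ₂ Φ₁ ((prodHomeomorphL2 Φ₂ Φ₁).symm (y, s))
  rw [Homeomorph.apply_symm_apply] at h
  have h' := congrArg (prodHomeomorphL2 Φ₁ Φ₂).symm h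
  rw [Homeomorph.symm_apply_apply] at h'
  rw [h']

omit [DecidableEq ι₁] [DecidableEq ι₂] in
/-- The class does not see a re-reading `Fin m = Fin n` of the enumeration. [folklore] -/
private theorem analyticCycleClass_finCongr_trans {ι : Type*} [Fintype ι] [DecidableEq ι] {E : Type u}
    [NormedAddCommGroup E] [InnerProductSpace ℂ E] [FiniteDimensional ℂ E] [MeasurableSpace E] [BorelSpace E]
    (Φ : (ι → ℝ) ≃L[ℝ] E) {m n d k : ℕ} (hmn : m = n) (e : Fin n ≃ ι) (hX : 2 * d + k = m) (hX' : 2 * d + k = n)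
    {Z : Set (ComplexTorus Φ)} (hZ : HasPureDim 𝓘(ℂ, E) Z d) :
    analyticCycleClass Φ ((finCongr hmn).trans e) hX hZ = analyticCycleClass Φ e hX' hZ := by
  subst hmn; rfl

omit [Fintype ι₁] [Fintype ι₂] [DecidableEq ι₁] [FiniteDimensional ℂ E₁] [MeasurableSpace E₁] [BorelSpace E₁]
  [InnerProductSpace ℂ E₂] [FiniteDimensional ℂ E₂] [MeasurableSpace E₂] [BorelSpace E₂] in
/-- The orientation sign does not see a re-reading `Fin m = Fin n` of the enumeration. [folklore] -/
private theorem orientationSign_finCongr_trans₃₆ {ι : Type*} [DecidableEq ι] {E : Type*} [NormedAddCommGroup E]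
    [NormedSpace ℂ E] (Φ : (ι → ℝ) ≃L[ℝ] E) {m n : ℕ} (hmn : m = n) (e : Fin n ≃ ι) :
    orientationSign Φ ((finCongr hmn).trans e) = orientationSign Φ e := by
  subst hmn; rfl

open Classical in
/-- **The class of the generic slice over the FIRST factor is the restriction along `i₁`**: for
`Z ⊆ X₁ × X₂` closed analytic of pure dimension `q + dim X₁` (`0 < q`, `0 < dim X₁`), codimension `p`, for
Haar-a.e. `s ∈ X₁`, `cl_{e₂}(Zˢ) = sign(e₁) · i₁^*[Z]_{e₁ ⊔ e₂}`, `Zˢ = {y | (s, y) ∈ Z}`, `i₁ : y ↦ (0, y)`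
— §2 for the transpose `ᵗZ ⊆ X₂ × X₁` and `[ᵗZ] = ± [Z] ∘ swap` (`analyticCycleClass_preimage_swap`), the
signs collecting to `sign(e₂) sign(e₂ ⊔ e₁)² sign(e₁ ⊔ e₂) = sign(e₁)`.
[cite: Fulton1998, §10.1 Example 10.1.2 and §19.2 Cor. 19.2 (b)] [cite: Lange2023AbelianVarietiesComplex, §6.2.2 p. 304]
[cite: Federer1969, 4.3.1–4.3.2] -/
theorem ae_volume_setCycleClass_fstSlice_eq_inr_pullback (hE₁ : 0 < finrank ℂ E₁) {q : ℕ} (hq : 0 < q)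
    (h₂ : 2 * q + 2 * p = n₂) (hk : 2 * (q + finrank ℂ E₁) + 2 * p = n₁ + n₂)
    {Z : Set (ComplexTorus (prodPeriodL2 Φ₁ Φ₂))} (hZ : HasPureDim 𝓘(ℂ, WithLp 2 (E₁ × E₂)) Z (q + finrank ℂ E₁)) :
    ∀ᵐ s ∂(volume : Measure (ComplexTorus Φ₁)),
      setCycleClass Φ₂ e₂ h₂ {y : ComplexTorus Φ₂ | (prodHomeomorphL2 Φ₁ Φ₂).symm (s, y) ∈ Z} =
        (orientationSign Φ₁ e₁ : ℂ) •
          (analyticCycleClass (prodPeriodL2 Φ₁ Φ₂) (sumEnum e₁ e₂) hk hZ).compContinuousLinearMap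
            (realRep Φ₂ (prodPeriodL2 Φ₁ Φ₂) (inrMatrix ι₁ ι₂)) := by
  -- the transpose `ᵗZ ⊆ X₂ × X₁`
  have hsw := isIsogeny_swap Φ₂ Φ₁
  have hZt : HasPureDim 𝓘(ℂ, WithLp 2 (E₂ × E₁))
      (mapMatrix (prodPeriodL2 Φ₂ Φ₁) (prodPeriodL2 Φ₁ Φ₂)
        (Matrix.fromBlocks (0 : Matrix ι₁ ι₂ ℤ) (1 : Matrix ι₁ ι₁ ℤ) (1 : Matrix ι₂ ι₂ ℤ) (0 : Matrix ι₂ ι₁ ℤ)) ⁻¹' Z)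
      (q + finrank ℂ E₁) :=
    hsw.hasPureDim_preimage (prodPeriodL2 Φ₂ Φ₁) (prodPeriodL2 Φ₁ Φ₂) hZ
  have hk' : 2 * (q + finrank ℂ E₁) + 2 * p = n₂ + n₁ := by omega
  -- §2 for `ᵗZ` over its second factor `X₁`
  have hae := ae_volume_setCycleClass_fibreSlice_eq_inl_pullback Φ₂ Φ₁ e₂ hE₁ (sumEnum e₂ e₁) hq h₂ hk' hZt
  -- `[ᵗZ]_{e₂ ⊔ e₁} = ± [Z]_{e₁ ⊔ e₂} ∘ swap`
  have hT := analyticCycleClass_preimage_swap Φ₁ Φ₂ (e := sumEnum e₂ e₁)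
    (e' := (finCongr (Nat.add_comm n₂ n₁)).trans (sumEnum e₁ e₂)) hsw hZ hk'
  rw [analyticCycleClass_finCongr_trans (prodPeriodL2 Φ₁ Φ₂) (Nat.add_comm n₂ n₁) (sumEnum e₁ e₂) hk' hk hZ,
    orientationSign_finCongr_trans₃₆ (prodPeriodL2 Φ₁ Φ₂) (Nat.add_comm n₂ n₁) (sumEnum e₁ e₂)] at hT
  -- signs: `sign(e₂) sign(e₂ ⊔ e₁) · sign(e₂ ⊔ e₁) sign(e₁ ⊔ e₂) = sign(e₁)`
  have hsign : ((orientationSign Φ₂ e₂ * orientationSign (prodPeriod Φ₂ Φ₁) (sumEnum e₂ e₁) : ℤ) : ℂ) *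
      ((orientationSign (prodPeriodL2 Φ₂ Φ₁) (sumEnum e₂ e₁) *
        orientationSign (prodPeriodL2 Φ₁ Φ₂) (sumEnum e₁ e₂) : ℤ) : ℂ) = (orientationSign Φ₁ e₁ : ℂ) := by
    rw [orientationSign_sumEnum_eq_mul Φ₂ Φ₁ e₂ e₁, orientationSign_prodPeriodL2_sumEnum Φ₂ Φ₁ e₂ e₁,
      orientationSign_prodPeriodL2_sumEnum Φ₁ Φ₂ e₁ e₂]
    rcases orientationSign_eq_or Φ₁ e₁ with h1 | h1 <;> rcases orientationSign_eq_or Φ₂ e₂ with h2 | h2 <;>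
      simp only [h1, h2] <;> norm_num
  -- the composite `swap ∘ i₀' = i₁`
  have hcomp : ((analyticCycleClass (prodPeriodL2 Φ₁ Φ₂) (sumEnum e₁ e₂) hk hZ).compContinuousLinearMap
      (((WithLp.prodContinuousLinearEquiv 2 ℝ E₁ E₂).symm : E₁ × E₂ →L[ℝ] WithLp 2 (E₁ × E₂)).comp
        ((ContinuousLinearEquiv.prodComm ℝ E₂ E₁ : E₂ × E₁ →L[ℝ] E₁ × E₂).comp
          (WithLp.prodContinuousLinearEquiv 2 ℝ E₂ E₁ : WithLp 2 (E₂ × E₁) →L[ℝ] E₂ × E₁)))).compContinuousLinearMap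
      (realRep Φ₂ (prodPeriodL2 Φ₂ Φ₁) (inlMatrix ι₂ ι₁)) =
      (analyticCycleClass (prodPeriodL2 Φ₁ Φ₂) (sumEnum e₁ e₂) hk hZ).compContinuousLinearMap
        (realRep Φ₂ (prodPeriodL2 Φ₁ Φ₂) (inrMatrix ι₁ ι₂)) := by
    ext v
    simp only [ContinuousAlternatingMap.compContinuousLinearMap_apply, Function.comp_def,
      ContinuousLinearMap.coe_comp, realRep_inlMatrix_prodPeriodL2_apply, realRep_inrMatrix_prodPeriodL2_apply]
    rfl
  filter_upwards [hae] with s hs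
  rw [fibreSlice_preimage_swap_eq] at hs
  rw [hs, hT, complex_smul_compContinuousLinearMap₃₆, smul_smul, hsign, hcomp]

open Classical in
/-- **`K_{2p}[Z] = sign(e₁) · pr₂^* cl_{e₂}(Zˢ)` for Haar-a.e. `s ∈ X₁`** (`Z ⊆ X₁ × X₂` closed analytic of
pure dimension `q + dim X₁`, `0 < q`, `0 < dim X₁`): the Künneth component of type `(0, 2p)` is
`pr₂^* i₁^*[Z]`. [cite: Lange2023AbelianVarietiesComplex, §6.3.3 (6.14)–(6.16)] [cite: Fulton1998, §10.1 Example 10.1.2] -/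
theorem ae_kunnethComponent_self_analyticCycleClass_eq (hE₁ : 0 < finrank ℂ E₁) {q : ℕ} (hq : 0 < q)
    (h₂ : 2 * q + 2 * p = n₂) (hk : 2 * (q + finrank ℂ E₁) + 2 * p = n₁ + n₂)
    {Z : Set (ComplexTorus (prodPeriodL2 Φ₁ Φ₂))} (hZ : HasPureDim 𝓘(ℂ, WithLp 2 (E₁ × E₂)) Z (q + finrank ℂ E₁)) :
    ∀ᵐ s ∂(volume : Measure (ComplexTorus Φ₁)),
      (kunnethComponent (2 * p) ((analyticCycleClass (prodPeriodL2 Φ₁ Φ₂) (sumEnum e₁ e₂) hk hZ).compContinuousLinearMap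
          ((WithLp.prodContinuousLinearEquiv 2 ℝ E₁ E₂).symm : E₁ × E₂ →L[ℝ] WithLp 2 (E₁ × E₂)))).compContinuousLinearMap
        (WithLp.prodContinuousLinearEquiv 2 ℝ E₁ E₂ : WithLp 2 (E₁ × E₂) →L[ℝ] E₁ × E₂) =
      (orientationSign Φ₁ e₁ : ℂ) •
        (setCycleClass Φ₂ e₂ h₂ {y : ComplexTorus Φ₂ | (prodHomeomorphL2 Φ₁ Φ₂).symm (s, y) ∈ Z}).compContinuousLinearMap
          ((ContinuousLinearMap.snd ℝ E₁ E₂).comp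
            (WithLp.prodContinuousLinearEquiv 2 ℝ E₁ E₂ : WithLp 2 (E₁ × E₂) →L[ℝ] E₁ × E₂)) := by
  have hss₁ : ((orientationSign Φ₁ e₁ : ℤ) : ℂ) * orientationSign Φ₁ e₁ = 1 := by
    exact_mod_cast orientationSign_mul_self Φ₁ e₁
  filter_upwards [ae_volume_setCycleClass_fstSlice_eq_inr_pullback Φ₁ Φ₂ e₁ e₂ hE₁ hq h₂ hk hZ] with s hs
  rw [kunnethComponent_self_compContinuousLinearMap_eq Φ₁ Φ₂, hs, complex_smul_compContinuousLinearMap₃₆, smul_smul,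
    hss₁, one_smul]

open Classical in
/-- **`K_{2p}[Z] = [X₁ × Zˢ]` for Haar-a.e. `s ∈ X₁`.** For `Z ⊆ X₁ × X₂` closed analytic of pure dimension
`q + dim X₁` (`0 < q`, `0 < dim X₁`) and Haar-a.e. `s ∈ X₁`: either the slice `Zˢ = {y | (s, y) ∈ Z}` is
empty and `K_{2p}[Z] = 0`, or `Zˢ` is of pure dimension `q` and the Künneth component of type `(0, 2p)` of
`[Z]_{e₁ ⊔ e₂}` is the class `[X₁ × Zˢ]_{e₁ ⊔ e₂}` (`[X₁ × Z₂] = sign(e₁) · pr₂^*[Z₂]`,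
`analyticCycleClass_prodL2_univ_prod`). [cite: Lange2023AbelianVarietiesComplex, §6.3.3 Prop. 6.3.8]
[cite: Fulton1998, §10.1 Example 10.1.2 and §19.2] -/
theorem ae_kunnethComponent_self_analyticCycleClass_eq_univ_prod (hE₁ : 0 < finrank ℂ E₁) {q : ℕ} (hq : 0 < q)
    (h₂ : 2 * q + 2 * p = n₂) (hk : 2 * (q + finrank ℂ E₁) + 2 * p = n₁ + n₂)
    {Z : Set (ComplexTorus (prodPeriodL2 Φ₁ Φ₂))} (hZ : HasPureDim 𝓘(ℂ, WithLp 2 (E₁ × E₂)) Z (q + finrank ℂ E₁)) :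
    ∀ᵐ s ∂(volume : Measure (ComplexTorus Φ₁)),
      ({y : ComplexTorus Φ₂ | (prodHomeomorphL2 Φ₁ Φ₂).symm (s, y) ∈ Z} = ∅ ∧
        (kunnethComponent (2 * p) ((analyticCycleClass (prodPeriodL2 Φ₁ Φ₂) (sumEnum e₁ e₂) hk hZ).compContinuousLinearMap
            ((WithLp.prodContinuousLinearEquiv 2 ℝ E₁ E₂).symm : E₁ × E₂ →L[ℝ] WithLp 2 (E₁ × E₂)))).compContinuousLinearMap
          (WithLp.prodContinuousLinearEquiv 2 ℝ E₁ E₂ : WithLp 2 (E₁ × E₂) →L[ℝ] E₁ × E₂) = 0) ∨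
      ∃ hZs : HasPureDim 𝓘(ℂ, E₂) {y : ComplexTorus Φ₂ | (prodHomeomorphL2 Φ₁ Φ₂).symm (s, y) ∈ Z} q,
        (kunnethComponent (2 * p) ((analyticCycleClass (prodPeriodL2 Φ₁ Φ₂) (sumEnum e₁ e₂) hk hZ).compContinuousLinearMap
            ((WithLp.prodContinuousLinearEquiv 2 ℝ E₁ E₂).symm : E₁ × E₂ →L[ℝ] WithLp 2 (E₁ × E₂)))).compContinuousLinearMap
          (WithLp.prodContinuousLinearEquiv 2 ℝ E₁ E₂ : WithLp 2 (E₁ × E₂) →L[ℝ] E₁ × E₂) =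
          analyticCycleClass (prodPeriodL2 Φ₁ Φ₂) (sumEnum e₁ e₂)
            (by omega : 2 * (finrank ℂ E₁ + q) + 2 * p = n₁ + n₂)
            (hasPureDim_preimage_prodHomeomorphL2_univ_prod Φ₁ Φ₂ hZs) := by
  have hn₁ : 2 * finrank ℂ E₁ + 0 = n₁ := by have := finrank_complex_mul_two Φ₁ e₁; omega
  -- the slices over the first factor are a.e. empty or pure-dimensional (via the transpose)
  have hZt : HasPureDim 𝓘(ℂ, WithLp 2 (E₂ × E₁))
      (mapMatrix (prodPeriodL2 Φ₂ Φ₁) (prodPeriodL2 Φ₁ Φ₂)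
        (Matrix.fromBlocks (0 : Matrix ι₁ ι₂ ℤ) (1 : Matrix ι₁ ι₁ ℤ) (1 : Matrix ι₂ ι₂ ℤ) (0 : Matrix ι₂ ι₁ ℤ)) ⁻¹' Z)
      (q + finrank ℂ E₁) :=
    (isIsogeny_swap Φ₂ Φ₁).hasPureDim_preimage (prodPeriodL2 Φ₂ Φ₁) (prodPeriodL2 Φ₁ Φ₂) hZ
  have hdich := ae_volume_fibreSlice_eq_empty_or_hasPureDim Φ₂ Φ₁ (q := q) hZt
  filter_upwards [ae_kunnethComponent_self_analyticCycleClass_eq Φ₁ Φ₂ e₁ e₂ hE₁ hq h₂ hk hZ, hdich] with s hs hd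
  rw [fibreSlice_preimage_swap_eq] at hd
  rcases hd with h | h
  · refine Or.inl ⟨h, ?_⟩
    rw [hs, h, setCycleClass_empty₂]
    have h0 : (0 : E₂ [⋀^Fin (2 * p)]→L[ℝ] ℂ).compContinuousLinearMap ((ContinuousLinearMap.snd ℝ E₁ E₂).comp
        (WithLp.prodContinuousLinearEquiv 2 ℝ E₁ E₂ : WithLp 2 (E₁ × E₂) →L[ℝ] E₁ × E₂)) = 0 :=
      ContinuousAlternatingMap.ext fun v ↦ rfl
    rw [h0, smul_zero]
  · refine Or.inr ⟨h, ?_⟩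
    rw [hs, setCycleClass_of_hasPureDim Φ₂ e₂ h₂ h, analyticCycleClass_prodL2_univ_prod Φ₁ Φ₂ e₁ e₂ h hn₁ h₂]

end Torus

end ComplexTorus

end Literature.Geometry.Kaehler
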